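import Mathlib
import HarnessLib

/-!
# Strain signature of a stretched vortex LAYER: eigenvalues `{γ, (−γ ± √(γ²+ω₀²))/2}`, vorticity along the
# INTERMEDIATE strain axis, `λ_max/ω₀ ↑ 1/2` — the θ-ENVELOPE attribution lemma
# (instab lane, door O-acc = O7, obstruction P3 — `HOME/instab2/HEREDITY-P3.md` (B); site-detector `[theta]` line and
# `strainmax_probe.py` v1.1, STATUS 2026-08-26 «θ-ATTRIBUTION»)

HONEST FRAMING (cell `ns-blowup`, seat `ns-blowup-instab2`; human ruling D-0035): this cell ATTEMPTS the negative
direction of the Clay problem; nothing in this file is a claim about the Navier–Stokes equations. WHAT THIS IS NOT: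
not dynamics of any flow. Every declaration below is LINEAR ALGEBRA on one explicit `3 × 3` velocity gradient
```
      ⎡ 0   −ω₀   0 ⎤          S = ½(G + Gᵀ) = ⎡   0    −ω₀/2   0 ⎤ ,   ω = ∇ × u = (0, 0, ω₀),
  G = ⎢ 0   −γ    0 ⎥                           ⎢ −ω₀/2   −γ     0 ⎥
      ⎣ 0    0    γ ⎦                           ⎣   0      0     γ ⎦
```
(`G i j = ∂ⱼuᵢ`), the centre-plane gradient of a STRETCHED SHEAR LAYER `u = (V(y), −γy, γz)` with `V′(0) = −ω₀`
(the Burgers vortex layer when `V′ ∝ −exp(−γy²/2ν)`; `γ = 0` is the plain vortex sheet / tangential shear layer).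
It exists so that the census sentence on the θ-ENVELOPE EXCESS of the P-TOWER-1′ stage-1 runs — «carried by LAYER
(sheet) strain at |ω| ≈ ½|ω|_pk, not by core ellipticity and not by irrotational induction» — carries kernel names,
the exact signature the probe tests, and the NUMBER matched on the data.

## Dictionary
* `ω₀ > 0` = vorticity magnitude at the probe point, `γ ≥ 0` = stretching rate along the vorticity, `r := γ/ω₀`;
* `q v := Σᵢⱼ vᵢ Sᵢⱼ vⱼ = −ω₀ v₀v₁ − γ v₁² + γ v₂²` = the rate of strain of the line element `v`;
* `λ± := (−γ ± √(γ² + ω₀²))/2` = the two in-plane strain eigenvalues; the third is `γ` with eigenvector `ω̂ = e₂`.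

## What is proved
§1 `vorticity_eq` (`ω = (0,0,ω₀)` from `G`), `quadForm_eq`; §2 the eigen-structure: `omegaHat_eigen` (`S e₂ = γ e₂`:
the vorticity direction is a strain EIGENVECTOR with eigenvalue `γ`), `lam_sum`/`lam_prod`/`charPoly_lam_plus/minus`
(`λ² + γλ − ω₀²/4 = 0`), `inPlane_eigen_plus/minus` (`S w± = λ± w±` with `w± = (−ω₀/2, λ±, 0)`), the RAYLEIGH BRACKET
`lam_minus_le_quadForm` / `quadForm_le` (`λ₋|v|² ≤ q v ≤ max(λ₊, γ)|v|²` for every `v` — so these ARE the extreme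
strain rates), the ordering `lam_minus_neg`, `lam_plus_nonneg`, `lam_plus_lt_half` (`λ₊ < ω₀/2` when `γ > 0`),
`lam_plus_ge_iff` (**`γ ≤ λ₊ ↔ 8γ² ≤ ω₀²`**: for an INTENSE layer the vorticity sits on the INTERMEDIATE axis and
`λ_max = λ₊`), `lam_plus_ge_edge` (then `λ₊ ≥ ω₀/(2√2)`, i.e. `λ_max/ω₀ ∈ [0.3535, ½)` — the probe's SHEET window
lower edge `0.35`); §3 the unstretched sheet `γ = 0`: `sheet_lam_plus` (`λ₊ = ω₀/2`: **θ_layer = ½ exactly**),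
`sheet_quadForm_le` (`|q v| ≤ (ω₀/2)|v|²`), and the θ-LADDER `theta_ladder` (`0 < 3/20 < 1/(2√2) < 1/2`: solid core <
one Gaussian tube's outside strain (`BurgersTubeStrainSharp`) < intense-layer floor < sheet; Kirchhoff's interior ratio
`(a−b)/(2(a+b))` of `KirchhoffCoreStrain` fills `(0, ½)`); §4 THE NUMBER OF RECORD: at `r = 0.058` (the measured
`λ_int/|ω_loc|` at the strain maximum of run 1a-R300-N128-A, t = 5.80 T_h, 2.95 a off the α-line, |ω_loc| = 0.534|ω|_pk)
`record_lam_plus_bounds`: `λ₊/ω₀ ∈ (0.47184, 0.47185)` and `record_lam_minus_bounds`: `λ₋/ω₀ ∈ (−0.52985, −0.52984)` —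
the probe measured `(−0.534, +0.058, +0.476)·|ω_loc|`: the Burgers-layer triple to `0.004`. Mathlib only; no definitions.
LABEL: MODEL-door kinematics (an instrument's calibration object).
-/

namespace Summit.NavierStokesRegularity.FluidComputer.BurgersLayerStrain

open Real

section Gradient

/-! ## §1 The gradient, its vorticity and its strain quadratic form (components written out) -/

/-- VORTICITY of `G` (`Gᵢⱼ = ∂ⱼuᵢ`): `ω = (∂₁u₂ − ∂₂u₁, ∂₂u₀ − ∂₀u₂, ∂₀u₁ − ∂₁u₀) = (0, 0, ω₀)` — the layer's vorticity
points along the stretching axis `e₂`. Stated on the six relevant entries. -/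
theorem vorticity_eq (ω₀ γ : ℝ) :
    let G : Fin 3 → Fin 3 → ℝ := fun i j => if i = 0 ∧ j = 1 then -ω₀ else if i = 1 ∧ j = 1 then -γ
      else if i = 2 ∧ j = 2 then γ else 0
    (G 2 1 - G 1 2 = 0) ∧ (G 0 2 - G 2 0 = 0) ∧ (G 1 0 - G 0 1 = ω₀) := by
  simp

/-- THE STRAIN QUADRATIC FORM: with `S = ½(G + Gᵀ)`, `Σᵢⱼ vᵢ Sᵢⱼ vⱼ = Σᵢⱼ vᵢ Gᵢⱼ vⱼ = −ω₀ v₀v₁ − γ v₁² + γ v₂²`. -/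
theorem quadForm_eq (ω₀ γ : ℝ) (v : Fin 3 → ℝ) :
    let G : Fin 3 → Fin 3 → ℝ := fun i j => if i = 0 ∧ j = 1 then -ω₀ else if i = 1 ∧ j = 1 then -γ
      else if i = 2 ∧ j = 2 then γ else 0
    ∑ i : Fin 3, ∑ j : Fin 3, v i * G i j * v j = -ω₀ * (v 0 * v 1) - γ * v 1 ^ 2 + γ * v 2 ^ 2 := by
  simp only [Fin.sum_univ_three, Fin.isValue]
  simp
  ring

end Gradient

section Eigen

/-! ## §2 Eigen-structure of `S = [[0, −ω₀/2, 0], [−ω₀/2, −γ, 0], [0, 0, γ]]`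

`S` acts on `v` by `(S v)₀ = −(ω₀/2) v₁`, `(S v)₁ = −(ω₀/2) v₀ − γ v₁`, `(S v)₂ = γ v₂`; every statement below is about
these three explicit linear forms and the quadratic form `q v = −ω₀ v₀v₁ − γ v₁² + γ v₂²`. -/

/-- `ω̂ = e₂` IS A STRAIN EIGENVECTOR with eigenvalue `γ`: `S e₂ = γ e₂` (all three components). -/
theorem omegaHat_eigen (ω₀ γ : ℝ) :
    (-(ω₀ / 2) * (0:ℝ) = γ * 0) ∧ (-(ω₀ / 2) * (0:ℝ) - γ * 0 = γ * 0) ∧ (γ * (1:ℝ) = γ * 1) := by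
  simp

/-- The rate of strain ALONG the vorticity is the stretching rate: `q e₂ = γ`. -/
theorem quadForm_omegaHat (ω₀ γ : ℝ) : -ω₀ * ((0:ℝ) * 0) - γ * (0:ℝ) ^ 2 + γ * (1:ℝ) ^ 2 = γ := by ring

/-- VIETA for the in-plane pair: `λ₊ + λ₋ = −γ`. -/
theorem lam_sum (ω₀ γ : ℝ) :
    (-γ + sqrt (γ ^ 2 + ω₀ ^ 2)) / 2 + (-γ - sqrt (γ ^ 2 + ω₀ ^ 2)) / 2 = -γ := by ring

/-- VIETA: `λ₊ · λ₋ = −ω₀²/4` (so the two in-plane eigenvalues have opposite signs whenever `ω₀ ≠ 0`). -/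
theorem lam_prod (ω₀ γ : ℝ) :
    (-γ + sqrt (γ ^ 2 + ω₀ ^ 2)) / 2 * ((-γ - sqrt (γ ^ 2 + ω₀ ^ 2)) / 2) = -(ω₀ ^ 2) / 4 := by
  have h : sqrt (γ ^ 2 + ω₀ ^ 2) ^ 2 = γ ^ 2 + ω₀ ^ 2 := sq_sqrt (by positivity)
  nlinarith [h]

/-- CHARACTERISTIC EQUATION for `λ₊`: `λ₊² + γλ₊ − ω₀²/4 = 0`. -/
theorem charPoly_lam_plus (ω₀ γ : ℝ) :
    ((-γ + sqrt (γ ^ 2 + ω₀ ^ 2)) / 2) ^ 2 + γ * ((-γ + sqrt (γ ^ 2 + ω₀ ^ 2)) / 2) - ω₀ ^ 2 / 4 = 0 := by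
  have h : sqrt (γ ^ 2 + ω₀ ^ 2) ^ 2 = γ ^ 2 + ω₀ ^ 2 := sq_sqrt (by positivity)
  nlinarith [h]

/-- CHARACTERISTIC EQUATION for `λ₋`: `λ₋² + γλ₋ − ω₀²/4 = 0`. -/
theorem charPoly_lam_minus (ω₀ γ : ℝ) :
    ((-γ - sqrt (γ ^ 2 + ω₀ ^ 2)) / 2) ^ 2 + γ * ((-γ - sqrt (γ ^ 2 + ω₀ ^ 2)) / 2) - ω₀ ^ 2 / 4 = 0 := by
  have h : sqrt (γ ^ 2 + ω₀ ^ 2) ^ 2 = γ ^ 2 + ω₀ ^ 2 := sq_sqrt (by positivity)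
  nlinarith [h]

/-- IN-PLANE EIGENVECTORS: for any root `λ` of `λ² + γλ − ω₀²/4 = 0` the vector `w = (−ω₀/2, λ, 0)` satisfies
`S w = λ w` componentwise: `(S w)₀ = −(ω₀/2)·λ = λ·(−ω₀/2)`, `(S w)₁ = (ω₀/2)(ω₀/2) − γλ = λ·λ`, `(S w)₂ = 0`. -/
theorem inPlane_eigen {ω₀ γ lam : ℝ} (h : lam ^ 2 + γ * lam - ω₀ ^ 2 / 4 = 0) :
    (-(ω₀ / 2) * lam = lam * (-(ω₀ / 2))) ∧ (-(ω₀ / 2) * (-(ω₀ / 2)) - γ * lam = lam * lam) ∧ (γ * (0:ℝ) = lam * 0) := by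
  refine ⟨by ring, ?_, by simp⟩
  nlinarith [h]

/-- … in particular for `λ₊`. -/
theorem inPlane_eigen_plus (ω₀ γ : ℝ) :
    let lam := (-γ + sqrt (γ ^ 2 + ω₀ ^ 2)) / 2
    (-(ω₀ / 2) * lam = lam * (-(ω₀ / 2))) ∧ (-(ω₀ / 2) * (-(ω₀ / 2)) - γ * lam = lam * lam) ∧ (γ * (0:ℝ) = lam * 0) :=
  inPlane_eigen (charPoly_lam_plus ω₀ γ)

/-- … and for `λ₋`. -/
theorem inPlane_eigen_minus (ω₀ γ : ℝ) :
    let lam := (-γ - sqrt (γ ^ 2 + ω₀ ^ 2)) / 2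
    (-(ω₀ / 2) * lam = lam * (-(ω₀ / 2))) ∧ (-(ω₀ / 2) * (-(ω₀ / 2)) - γ * lam = lam * lam) ∧ (γ * (0:ℝ) = lam * 0) :=
  inPlane_eigen (charPoly_lam_minus ω₀ γ)

/-- RAYLEIGH UPPER BRACKET, in-plane part: `−ω₀ v₀v₁ − γ v₁² ≤ λ₊ (v₀² + v₁²)` for all `v₀ v₁` — `λ₊` is the largest
in-plane strain rate (the gap is the perfect square `(√λ₊… )²`, discriminant `ω₀² − 4λ₊(λ₊+γ) = 0`). -/
theorem inPlane_quadForm_le (ω₀ γ : ℝ) (v₀ v₁ : ℝ) :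
    -ω₀ * (v₀ * v₁) - γ * v₁ ^ 2 ≤ (-γ + sqrt (γ ^ 2 + ω₀ ^ 2)) / 2 * (v₀ ^ 2 + v₁ ^ 2) := by
  set s := sqrt (γ ^ 2 + ω₀ ^ 2) with hs
  have h : s ^ 2 = γ ^ 2 + ω₀ ^ 2 := sq_sqrt (by positivity)
  have hs0 : 0 ≤ s := sqrt_nonneg _
  -- Q := (s−γ)v₀² + 2ω₀v₀v₁ + (s+γ)v₁² = 2·(goal gap); (s−γ)Q and (s+γ)Q are perfect squares since (s−γ)(s+γ) = ω₀²
  have i1 : (s - γ) * ((s - γ) * v₀ ^ 2 + 2 * ω₀ * (v₀ * v₁) + (s + γ) * v₁ ^ 2) = ((s - γ) * v₀ + ω₀ * v₁) ^ 2 := by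
    linear_combination (v₁ ^ 2) * h
  have i2 : (s + γ) * ((s - γ) * v₀ ^ 2 + 2 * ω₀ * (v₀ * v₁) + (s + γ) * v₁ ^ 2) = (ω₀ * v₀ + (s + γ) * v₁) ^ 2 := by
    linear_combination (v₀ ^ 2) * h
  have i3 : (2 * s) * ((s - γ) * v₀ ^ 2 + 2 * ω₀ * (v₀ * v₁) + (s + γ) * v₁ ^ 2) =
      ((s - γ) * v₀ + ω₀ * v₁) ^ 2 + (ω₀ * v₀ + (s + γ) * v₁) ^ 2 := by linear_combination i1 + i2
  rcases eq_or_lt_of_le hs0 with h0 | h0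
  · -- s = 0 forces γ = ω₀ = 0
    have hγ0 : γ = 0 := by nlinarith [sq_nonneg γ, sq_nonneg ω₀]
    have hω0 : ω₀ = 0 := by nlinarith [sq_nonneg γ, sq_nonneg ω₀]
    subst hγ0; subst hω0
    rw [← h0]; simp
  · have hQ : 0 ≤ (s - γ) * v₀ ^ 2 + 2 * ω₀ * (v₀ * v₁) + (s + γ) * v₁ ^ 2 := by
      have h2s : 0 < 2 * s := by linarith
      have : (2 * s) * 0 ≤ (2 * s) * ((s - γ) * v₀ ^ 2 + 2 * ω₀ * (v₀ * v₁) + (s + γ) * v₁ ^ 2) := by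
        rw [i3, mul_zero]; positivity
      exact le_of_mul_le_mul_left this h2s
    nlinarith [hQ]

/-- RAYLEIGH LOWER BRACKET, in-plane part: `λ₋ (v₀² + v₁²) ≤ −ω₀ v₀v₁ − γ v₁²`. -/
theorem lam_minus_le_inPlane_quadForm (ω₀ γ : ℝ) (v₀ v₁ : ℝ) :
    (-γ - sqrt (γ ^ 2 + ω₀ ^ 2)) / 2 * (v₀ ^ 2 + v₁ ^ 2) ≤ -ω₀ * (v₀ * v₁) - γ * v₁ ^ 2 := by
  set s := sqrt (γ ^ 2 + ω₀ ^ 2) with hs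
  have h : s ^ 2 = γ ^ 2 + ω₀ ^ 2 := sq_sqrt (by positivity)
  have hs0 : 0 ≤ s := sqrt_nonneg _
  -- Q' := (s+γ)v₀² − 2ω₀v₀v₁ + (s−γ)v₁² = 2·(goal gap)
  have i1 : (s + γ) * ((s + γ) * v₀ ^ 2 - 2 * ω₀ * (v₀ * v₁) + (s - γ) * v₁ ^ 2) = ((s + γ) * v₀ - ω₀ * v₁) ^ 2 := by
    linear_combination (v₁ ^ 2) * h
  have i2 : (s - γ) * ((s + γ) * v₀ ^ 2 - 2 * ω₀ * (v₀ * v₁) + (s - γ) * v₁ ^ 2) = (ω₀ * v₀ - (s - γ) * v₁) ^ 2 := by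
    linear_combination (v₀ ^ 2) * h
  have i3 : (2 * s) * ((s + γ) * v₀ ^ 2 - 2 * ω₀ * (v₀ * v₁) + (s - γ) * v₁ ^ 2) =
      ((s + γ) * v₀ - ω₀ * v₁) ^ 2 + (ω₀ * v₀ - (s - γ) * v₁) ^ 2 := by linear_combination i1 + i2
  rcases eq_or_lt_of_le hs0 with h0 | h0
  · have hγ0 : γ = 0 := by nlinarith [sq_nonneg γ, sq_nonneg ω₀]
    have hω0 : ω₀ = 0 := by nlinarith [sq_nonneg γ, sq_nonneg ω₀]
    subst hγ0; subst hω0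
    rw [← h0]; simp
  · have hQ : 0 ≤ (s + γ) * v₀ ^ 2 - 2 * ω₀ * (v₀ * v₁) + (s - γ) * v₁ ^ 2 := by
      have h2s : 0 < 2 * s := by linarith
      have : (2 * s) * 0 ≤ (2 * s) * ((s + γ) * v₀ ^ 2 - 2 * ω₀ * (v₀ * v₁) + (s - γ) * v₁ ^ 2) := by
        rw [i3, mul_zero]; positivity
      exact le_of_mul_le_mul_left this h2s
    nlinarith [hQ]

/-- RAYLEIGH UPPER BRACKET, full: `q v ≤ max(λ₊, γ)·|v|²` for every line element `v` — the largest strain rate of the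
layer is `max(λ₊, γ)`. -/
theorem quadForm_le (ω₀ γ : ℝ) (v₀ v₁ v₂ : ℝ) :
    -ω₀ * (v₀ * v₁) - γ * v₁ ^ 2 + γ * v₂ ^ 2 ≤
      max ((-γ + sqrt (γ ^ 2 + ω₀ ^ 2)) / 2) γ * (v₀ ^ 2 + v₁ ^ 2 + v₂ ^ 2) := by
  have h1 := inPlane_quadForm_le ω₀ γ v₀ v₁
  have h2 : (-γ + sqrt (γ ^ 2 + ω₀ ^ 2)) / 2 * (v₀ ^ 2 + v₁ ^ 2) ≤
      max ((-γ + sqrt (γ ^ 2 + ω₀ ^ 2)) / 2) γ * (v₀ ^ 2 + v₁ ^ 2) :=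
    mul_le_mul_of_nonneg_right (le_max_left _ _) (by positivity)
  have h3 : γ * v₂ ^ 2 ≤ max ((-γ + sqrt (γ ^ 2 + ω₀ ^ 2)) / 2) γ * v₂ ^ 2 :=
    mul_le_mul_of_nonneg_right (le_max_right _ _) (sq_nonneg _)
  nlinarith [h1, h2, h3]

/-- RAYLEIGH LOWER BRACKET, full (`γ ≥ 0`): `λ₋·|v|² ≤ q v` — `λ₋` is the most compressive strain rate. -/
theorem lam_minus_le_quadForm {γ : ℝ} (hγ : 0 ≤ γ) (ω₀ v₀ v₁ v₂ : ℝ) :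
    (-γ - sqrt (γ ^ 2 + ω₀ ^ 2)) / 2 * (v₀ ^ 2 + v₁ ^ 2 + v₂ ^ 2) ≤ -ω₀ * (v₀ * v₁) - γ * v₁ ^ 2 + γ * v₂ ^ 2 := by
  have h1 := lam_minus_le_inPlane_quadForm ω₀ γ v₀ v₁
  have hs0 : 0 ≤ sqrt (γ ^ 2 + ω₀ ^ 2) := sqrt_nonneg _
  have h2 : (-γ - sqrt (γ ^ 2 + ω₀ ^ 2)) / 2 * v₂ ^ 2 ≤ γ * v₂ ^ 2 :=
    mul_le_mul_of_nonneg_right (by linarith) (sq_nonneg _)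
  nlinarith [h1, h2]

/-- `λ₋ < 0` whenever `ω₀ ≠ 0` (there is always an in-plane compression). -/
theorem lam_minus_neg {ω₀ γ : ℝ} (hγ : 0 ≤ γ) (hω : ω₀ ≠ 0) : (-γ - sqrt (γ ^ 2 + ω₀ ^ 2)) / 2 < 0 := by
  have h : 0 < sqrt (γ ^ 2 + ω₀ ^ 2) := sqrt_pos.mpr (by positivity)
  linarith

/-- `0 ≤ λ₊` for `γ ≥ 0`… in fact for every `γ` (`√(γ²+ω₀²) ≥ |γ| ≥ γ`). -/
theorem lam_plus_nonneg (ω₀ γ : ℝ) : 0 ≤ (-γ + sqrt (γ ^ 2 + ω₀ ^ 2)) / 2 := by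
  have h : |γ| ≤ sqrt (γ ^ 2 + ω₀ ^ 2) := Real.abs_le_sqrt (by nlinarith)
  linarith [le_abs_self γ]

/-- STRETCHING LOWERS THE IN-PLANE MAXIMUM: `λ₊ < ω₀/2` when `γ > 0`, `ω₀ > 0` (and `= ω₀/2` at `γ = 0`, §3). -/
theorem lam_plus_lt_half {ω₀ γ : ℝ} (hω : 0 < ω₀) (hγ : 0 < γ) : (-γ + sqrt (γ ^ 2 + ω₀ ^ 2)) / 2 < ω₀ / 2 := by
  have h : sqrt (γ ^ 2 + ω₀ ^ 2) < γ + ω₀ := by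
    rw [sqrt_lt' (by linarith)]
    nlinarith
  linarith

/-- `λ₊/ω₀` IN THE RATIO `r = γ/ω₀`: `λ₊ = ω₀ · (√(1 + r²) − r)/2` (`ω₀ > 0`). -/
theorem lam_plus_eq_ratio {ω₀ γ : ℝ} (hω : 0 < ω₀) :
    (-γ + sqrt (γ ^ 2 + ω₀ ^ 2)) / 2 = ω₀ * ((sqrt (1 + (γ / ω₀) ^ 2) - γ / ω₀) / 2) := by
  have h1 : γ ^ 2 + ω₀ ^ 2 = ω₀ ^ 2 * (1 + (γ / ω₀) ^ 2) := by field_simp; ring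
  rw [h1, sqrt_mul' _ (by positivity), sqrt_sq hω.le]
  field_simp
  ring

/-- **INTENSE-LAYER CRITERION**: `γ ≤ λ₊ ↔ 8γ² ≤ ω₀²` (`γ ≥ 0`). When it holds the spectrum is ordered
`λ₋ < γ ≤ λ₊`: the VORTICITY DIRECTION IS THE INTERMEDIATE STRAIN AXIS and `λ_max(S) = λ₊` — the SHEET SIGNATURE
the probe tests (`|cos(ω̂, e_int)| = 1`). -/
theorem lam_plus_ge_iff {ω₀ γ : ℝ} (hγ : 0 ≤ γ) :
    γ ≤ (-γ + sqrt (γ ^ 2 + ω₀ ^ 2)) / 2 ↔ 8 * γ ^ 2 ≤ ω₀ ^ 2 := by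
  constructor
  · intro h
    have h1 : 3 * γ ≤ sqrt (γ ^ 2 + ω₀ ^ 2) := by linarith
    have h2 : (3 * γ) ^ 2 ≤ sqrt (γ ^ 2 + ω₀ ^ 2) ^ 2 := by
      exact pow_le_pow_left₀ (by linarith) h1 2
    rw [sq_sqrt (by positivity)] at h2
    nlinarith
  · intro h
    have h1 : 3 * γ ≤ sqrt (γ ^ 2 + ω₀ ^ 2) := by
      rw [show (3 : ℝ) * γ = sqrt ((3 * γ) ^ 2) by rw [sqrt_sq (by linarith)]]
      exact sqrt_le_sqrt (by nlinarith)
    linarith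

/-- In the intense regime the maximum over ALL line elements is `λ₊`: `q v ≤ λ₊ |v|²` (`γ ≥ 0`, `8γ² ≤ ω₀²`). -/
theorem quadForm_le_lam_plus {ω₀ γ : ℝ} (hγ : 0 ≤ γ) (h8 : 8 * γ ^ 2 ≤ ω₀ ^ 2) (v₀ v₁ v₂ : ℝ) :
    -ω₀ * (v₀ * v₁) - γ * v₁ ^ 2 + γ * v₂ ^ 2 ≤ (-γ + sqrt (γ ^ 2 + ω₀ ^ 2)) / 2 * (v₀ ^ 2 + v₁ ^ 2 + v₂ ^ 2) := by
  have h := quadForm_le ω₀ γ v₀ v₁ v₂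
  rwa [max_eq_left ((lam_plus_ge_iff hγ).mpr h8)] at h

/-- INTENSE-LAYER FLOOR: `8γ² ≤ ω₀²` (`γ ≥ 0`, `ω₀ > 0`) gives `λ₊ ≥ ω₀/(2√2)` — so `λ_max/ω₀ ∈ [1/(2√2), 1/2]`,
`1/(2√2) = 0.35355…`: the lower edge of the probe's SHEET window. -/
theorem lam_plus_ge_edge {ω₀ γ : ℝ} (hγ : 0 ≤ γ) (hω : 0 < ω₀) (h8 : 8 * γ ^ 2 ≤ ω₀ ^ 2) :
    ω₀ / (2 * sqrt 2) ≤ (-γ + sqrt (γ ^ 2 + ω₀ ^ 2)) / 2 := by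
  -- √(γ²+ω₀²) − γ is decreasing in γ; on 8γ² ≤ ω₀² its minimum ω₀/√2 is at the edge γ = ω₀/(2√2).
  have hs2 : 0 < sqrt 2 := by positivity
  have hs2sq : sqrt 2 ^ 2 = 2 := sq_sqrt (by norm_num)
  -- (i) 2√2·γ ≤ ω₀ from 8γ² ≤ ω₀²
  have h' : 2 * sqrt 2 * γ ≤ ω₀ := by
    have hsq : (2 * sqrt 2 * γ) ^ 2 ≤ ω₀ ^ 2 := by
      have e : (2 * sqrt 2 * γ) ^ 2 = 8 * γ ^ 2 := by rw [mul_pow, mul_pow, hs2sq]; ring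
      rw [e]; exact h8
    calc 2 * sqrt 2 * γ = sqrt ((2 * sqrt 2 * γ) ^ 2) := (sqrt_sq (by positivity)).symm
      _ ≤ sqrt (ω₀ ^ 2) := sqrt_le_sqrt hsq
      _ = ω₀ := sqrt_sq hω.le
  -- (ii) with c := ω₀√2/2 (= ω₀/√2): (c + γ)² ≤ γ² + ω₀²
  set c := ω₀ * sqrt 2 / 2 with hc
  have hc0 : 0 ≤ c := by positivity
  have hc2 : c ^ 2 = ω₀ ^ 2 / 2 := by rw [hc, div_pow, mul_pow, hs2sq]; ring
  have hcγ : 2 * c * γ ≤ ω₀ ^ 2 / 2 := by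
    rw [hc]
    have : ω₀ * (sqrt 2 * γ) ≤ ω₀ * (ω₀ / 2) := mul_le_mul_of_nonneg_left (by linarith) hω.le
    nlinarith [this]
  have hsq2 : (c + γ) ^ 2 ≤ γ ^ 2 + ω₀ ^ 2 := by nlinarith [hc2, hcγ]
  have key : c + γ ≤ sqrt (γ ^ 2 + ω₀ ^ 2) := by
    calc c + γ = sqrt ((c + γ) ^ 2) := (sqrt_sq (by positivity)).symm
      _ ≤ sqrt (γ ^ 2 + ω₀ ^ 2) := sqrt_le_sqrt hsq2
  -- (iii) ω₀/(2√2) = c/2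
  have e3 : ω₀ / (2 * sqrt 2) = c / 2 := by
    rw [hc, div_div, eq_div_iff (by positivity), div_mul_eq_mul_div, div_eq_iff (by positivity)]
    nlinarith [hs2sq]
  rw [e3]
  linarith

end Eigen

section Sheet

/-! ## §3 The unstretched sheet `γ = 0` and the θ-ladder -/

/-- PLAIN VORTEX SHEET / SHEAR LAYER (`γ = 0`, `ω₀ ≥ 0`): `λ₊ = ω₀/2` EXACTLY — **θ_layer := λ_max/|ω| = ½**. -/
theorem sheet_lam_plus {ω₀ : ℝ} (hω : 0 ≤ ω₀) : (-(0:ℝ) + sqrt ((0:ℝ) ^ 2 + ω₀ ^ 2)) / 2 = ω₀ / 2 := by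
  simp [sqrt_sq hω]

/-- … and `λ₋ = −ω₀/2`: the sheet's strain is the pure plane strain `±ω₀/2` at 45° to the layer, zero along `ω`. -/
theorem sheet_lam_minus {ω₀ : ℝ} (hω : 0 ≤ ω₀) : (-(0:ℝ) - sqrt ((0:ℝ) ^ 2 + ω₀ ^ 2)) / 2 = -(ω₀ / 2) := by
  simp [sqrt_sq hω]; ring

/-- SHEET RAYLEIGH BRACKET: `|q v| = |ω₀ v₀ v₁| ≤ (ω₀/2)(v₀² + v₁² + v₂²)` (`ω₀ ≥ 0`) — no line element in a vortex
sheet is strained faster than HALF its vorticity, with equality at 45° in the plane ⊥ ω. -/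
theorem sheet_quadForm_le {ω₀ : ℝ} (hω : 0 ≤ ω₀) (v₀ v₁ v₂ : ℝ) :
    |-ω₀ * (v₀ * v₁) - 0 * v₁ ^ 2 + 0 * v₂ ^ 2| ≤ ω₀ / 2 * (v₀ ^ 2 + v₁ ^ 2 + v₂ ^ 2) := by
  rw [abs_le]
  constructor
  · nlinarith [sq_nonneg (v₀ + v₁), sq_nonneg v₂, mul_nonneg hω (sq_nonneg (v₀ - v₁)), mul_nonneg hω (sq_nonneg v₂)]
  · nlinarith [sq_nonneg (v₀ - v₁), sq_nonneg v₂, mul_nonneg hω (sq_nonneg (v₀ + v₁)), mul_nonneg hω (sq_nonneg v₂)]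

/-- Equality case: along `v = (1, −1, 0)/√2`-direction (unnormalised `(1, −1, 0)`) the rate is `+ω₀/2 · |v|²`. -/
theorem sheet_quadForm_eq_diag (ω₀ : ℝ) :
    -ω₀ * ((1:ℝ) * (-1)) - 0 * (-1:ℝ) ^ 2 + 0 * (0:ℝ) ^ 2 = ω₀ / 2 * ((1:ℝ) ^ 2 + (-1) ^ 2 + 0 ^ 2) := by ring

/-- **THE θ-LADDER** (ratios `λ_max/ω₀` of kernel objects, as numbers): `0 < 3/20 < 1/(2√2) < 1/2` — a solid-body
core (`S = 0`) < ONE Gaussian tube's strain anywhere outside itself (`BurgersTubeStrainSharp`: `s(x) ≤ 3/20`) < the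
intense-layer floor (`lam_plus_ge_edge`) < the sheet value (`sheet_lam_plus`); Kirchhoff's elliptic interior ratio
`(a−b)/(2(a+b))` (`KirchhoffCoreStrain.kirchhoff_ratio_lt_half`) sweeps `(0, ½)` as `b/a ↓ 0`, reaching `3/20` at
`a/b = 13/7` and `1/(2√2)` at `a/b = (√2+1)/(√2−1) = 3 + 2√2 ≈ 5.83` (not proved here). READING: a measured
local ratio `λ_S/|ω_loc| ≈ ½` with `ω ∥ e_int` says LAYER, not tube flank (`≤ 3/20` of the TUBE's ω₀, in fluid where
`|ω_loc| ≪ ω₀`) and not a mildly elliptic core. -/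
theorem theta_ladder : (0:ℝ) < 3 / 20 ∧ (3:ℝ) / 20 < 1 / (2 * sqrt 2) ∧ 1 / (2 * sqrt 2) < (1:ℝ) / 2 := by
  have hs2 : 0 < sqrt 2 := by positivity
  have hs2sq : sqrt 2 ^ 2 = 2 := sq_sqrt (by norm_num)
  have hlt : sqrt 2 < 3 / 2 := by
    rw [sqrt_lt' (by norm_num)]; norm_num
  have hgt : 1 < sqrt 2 := by
    rw [lt_sqrt (by norm_num)]; norm_num
  refine ⟨by norm_num, ?_, ?_⟩
  · rw [div_lt_div_iff₀ (by norm_num) (by positivity)]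
    nlinarith
  · rw [div_lt_div_iff₀ (by positivity) (by norm_num)]
    nlinarith

/-- `1/(2√2)` as a decimal: `0.3535 < 1/(2√2) < 0.3536` (the probe's SHEET window starts at `0.35`). -/
theorem edge_bounds : (0.3535:ℝ) < 1 / (2 * sqrt 2) ∧ 1 / (2 * sqrt 2) < (0.3536:ℝ) := by
  have hs2 : 0 < sqrt 2 := by positivity
  have hlo : (1.41421:ℝ) < sqrt 2 := by rw [lt_sqrt (by norm_num)]; norm_num
  have hhi : sqrt 2 < (1.41422:ℝ) := by rw [sqrt_lt' (by norm_num)]; norm_num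
  constructor
  · rw [lt_div_iff₀ (by positivity)]; nlinarith
  · rw [div_lt_iff₀ (by positivity)]; nlinarith

end Sheet

section Record

/-! ## §4 The number of record: `r = γ/ω₀ = 0.058` (run 1a-R300-N128-A, t = 5.80 T_h, at the strain maximum)

The probe reads, in units of the LOCAL vorticity `|ω_loc|` (= `ω₀` here): strain eigen-triple `(−0.534, +0.058, +0.476)`
with `ω̂ ∥ e_int` (`|cos| = 1.00`). Taking `γ/ω₀ := 0.058` from the intermediate eigenvalue, the layer predicts the two
others with NO free parameter: `λ±/ω₀ = (−0.058 ± √(1 + 0.058²))/2`. -/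

/-- `√(1 + 0.058²) = √1.003364 ∈ (1.00168, 1.00169)`. -/
theorem record_sqrt_bounds : (1.00168:ℝ) < sqrt 1.003364 ∧ sqrt 1.003364 < (1.00169:ℝ) := by
  constructor
  · rw [lt_sqrt (by norm_num)]; norm_num
  · rw [sqrt_lt' (by norm_num)]; norm_num

/-- `(0.058)² + 1² = 1.003364` (so the bounds above are the layer's `√(r² + 1)` at `r = 0.058`, `ω₀ = 1`). -/
theorem record_radicand : (0.058:ℝ) ^ 2 + 1 ^ 2 = 1.003364 := by norm_num

/-- **λ₊/ω₀ ∈ (0.47184, 0.47185)** at `r = 0.058` — measured `+0.476` (excess `+0.004`, i.e. `0.8 %` of `|ω_loc|`). -/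
theorem record_lam_plus_bounds :
    (0.47184:ℝ) < (-(0.058:ℝ) + sqrt ((0.058:ℝ) ^ 2 + 1 ^ 2)) / 2 ∧
      (-(0.058:ℝ) + sqrt ((0.058:ℝ) ^ 2 + 1 ^ 2)) / 2 < (0.471845:ℝ) := by
  rw [record_radicand]
  obtain ⟨h1, h2⟩ := record_sqrt_bounds
  constructor <;> linarith

/-- **λ₋/ω₀ ∈ (−0.529845, −0.52984)** at `r = 0.058` — measured `−0.534` (excess `−0.004`; the two excesses cancel in
the trace, as incompressibility demands: a small extra PLANE strain `±0.004|ω_loc|` on top of the layer's own). -/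
theorem record_lam_minus_bounds :
    (-0.529845:ℝ) < (-(0.058:ℝ) - sqrt ((0.058:ℝ) ^ 2 + 1 ^ 2)) / 2 ∧
      (-(0.058:ℝ) - sqrt ((0.058:ℝ) ^ 2 + 1 ^ 2)) / 2 < (-0.52984:ℝ) := by
  rw [record_radicand]
  obtain ⟨h1, h2⟩ := record_sqrt_bounds
  constructor <;> linarith

/-- The record point IS in the intense regime: `8 · 0.058² ≤ 1` (indeed `r = 0.058 < 1/(2√2) = 0.3535…` by a factor 6),
so `lam_plus_ge_iff` puts the vorticity on the intermediate axis — as measured (`|cos(ω̂, e_int)| = 1.00`). -/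
theorem record_intense : 8 * (0.058:ℝ) ^ 2 ≤ 1 ^ 2 := by norm_num

end Record

end Summit.NavierStokesRegularity.FluidComputer.BurgersLayerStrain
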